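import Literature.NumberTheory.LFunctions.Zhang2022.DetectorEntangledConeWindow

/-!
# Zhang (2022), programme F-S3 (cell landau-siegel §E, KNIFE-EDGES §4 row K9): the anchor window of E-102 head 1 is
# SHARP — at the explicit anchor `a₀ = 3/2 > 1` the entangled cone FAILS (`¬ Det.ConePSD (3/2) (7/2)`)

Y. Zhang, *Discrete mean estimates and the Landau–Siegel zero*, arXiv:2211.02515v1 [Zhang2022LandauSiegel] — an
unrefereed manuscript under adjudication. **WHAT THIS IS NOT: not a claim about Theorems 1–2 of arXiv:2211.02515, about
Landau–Siegel zeros, or about Parity. What is proved is a statement about the programme's TYPED OBJECT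
`Det.FormDetDD` / `Det.ConePSD` / `Det.EdetCone` (the (A)-main-term block form of the det family, registry E-102) at an
anchor OUTSIDE the design class DET (`a ∈ (0,1)`): it moves no keep/kill word and no §E row («The programme SEARCHES and
TYPES; no claim about Landau–Siegel zeros, Theorems 1–2 of arXiv:2211.02515 or a repaired Margin232 until a kernel
theorem says so.»).**

The window of record of E-102 head 1 in the anchor is `[0,1]` (kernel: `Det.conePSD_of_mem_Ioo` p496401, SOS route;
closed window `Det.edetCone_Icc` / `Det.conePSD_one` p497352). KNIFE-EDGES §4 row **K9** (ls-theory g3 BOOK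
2026-08-27T04:42:45Z; paper lemma ls-B-ref-1 g4 SHARP-ANCHOR.md fa537d73b51bbd31: for `a ∈ (1,2)` the Robin coefficient
`θ cot θ` of the SOS boundary form is negative, so the cone fails — on rank-`≥ 2` anchor Gram matrices for every palette,
and node-dependently already at `K = 1`) asks for ONE explicit kernel cell. THIS FILE: the `K = 1` cell
`(a₀; x) = (3/2; 7/2)` with the LINEAR one-sided profile `g(y) = 1 − y` (`Repair.linProfile`). With `B = (a₀ + 2x)/2 = 17/4`
both node phases `e^{iπ(B − a₀)} = e^{11iπ/4}` and `e^{iπ(B − x)} = e^{3iπ/4}` are the SAME eighth root of unity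
`E = (−1 + i)/√2`, so the six confluent dd-moments (branch `y = z` of `Det.dd2`) are explicit elements of `ℚ(i,√2)[π]`:
`m₀ = −(7iπ/4)E`, `m_s = −(1 + 35iπ/4)E`, `m_n = −(147iπ/16)E`, `m_b = (1 − 49iπ/8)E`, `m_bs = −(245iπ/8)E`,
`m_bn = −(1029iπ/32)E` (Part 4), the profile integrals of `1 − y` are `1, −½, −½, ⅓, 1, ½, ⅛` (Part 5), and

  **`Det.FormDetDD ![3/2, 7/2, 7/2] g g′ = √2 · (11/4 − 21π/16 + 833π²/96 − 1029π³/256) = −57.0842475834… < 0`**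

(`formDetDD_cell_lin`, `formDetDD_cell_lin_neg`; the cubic is `< 0` for every `π > 3`). CERTIFIED BEFORE TYPING (theory
pre-condition (i)): lineage A ls-num-1 g4 kit j268885 (Arb 320-bit: `−57.0842475834117001239369 ± 2.9e-23`, six moments
to 22 digits = the closed forms above), lineage B ls-Bdet-num-2 g6 kit j268851 (K9-CELL-B.json 229a004704c9fbb1), desk
`ℚ(ζ₈)[π]` engine HOME/ls-Bdet-typer-2/k9exact.py; ls-ref-num g7 ledger l.7445 PASS A × B × desk.

Consequences (Part 7): **`not_conePSD_threeHalves : ¬ ConePSD (3/2) (7/2)`** (`Det.conePSD_fin_one_iff` +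
`Repair.kinkedProfile_lin`); `not_edetCone_of_mem` (no anchor set `∋ 3/2` and shift set `∋ 7/2` carry the row);
`not_edetCone_Ioo_of_gt` (`¬ EdetCone (0,a′) (0,5)` for every `a′ > 3/2`), `not_edetCone_Ioo_two`,
`not_edetCone_Icc_threeHalves`, and the two-sided K-window statement `edetCone_window_Icc_and_not :
EdetCone [0,1] (0,5) ∧ ¬ EdetCone [0,3/2] (0,5)`. 0 facts, 0 sorry, standard axioms. Cell landau-siegel,
ls-Bdet-typer-2 g3 (heads owner E-102).

References: Y. Zhang, arXiv:2211.02515v1 (2022), proof of Prop 7.1 (7.19)–(7.21), (7.2) p.44; §8 (8.11)–(8.23)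
[pp. 44–50]. [cite: Zhang2022LandauSiegel, Prop 7.1 p.44; §8 (8.11)–(8.23)]
-/

noncomputable section

open Complex Real Set intervalIntegral

namespace Literature.NumberTheory.LFunctions.Zhang2022

namespace Det

open Repair

/-! ### Part 1 — the one exponential value: `e^{3iπ/4} = e^{11iπ/4} = (−1 + i)/√2` -/

/-- `e^{3iπ/4} = −√2/2 + (√2/2)i`. [folklore] -/
private theorem cexp_three_pi_quarter :
    cexp (I * π * (((3 : ℝ) / 4 : ℝ) : ℂ)) = ((-(Real.sqrt 2 / 2) : ℝ) : ℂ) + ((Real.sqrt 2 / 2 : ℝ) : ℂ) * I := by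
  rw [show I * π * (((3 : ℝ) / 4 : ℝ) : ℂ) = (((π - π / 4) : ℝ) : ℂ) * I by push_cast; ring, Complex.exp_mul_I,
    ← Complex.ofReal_cos, ← Complex.ofReal_sin, Real.cos_pi_sub, Real.sin_pi_sub, Real.cos_pi_div_four,
    Real.sin_pi_div_four]

/-- `e^{11iπ/4} = e^{3iπ/4}`. [folklore] -/
private theorem cexp_eleven_pi_quarter :
    cexp (I * π * (((11 : ℝ) / 4 : ℝ) : ℂ)) = cexp (I * π * (((3 : ℝ) / 4 : ℝ) : ℂ)) := by
  rw [show I * π * (((11 : ℝ) / 4 : ℝ) : ℂ) = 2 * π * I + I * π * (((3 : ℝ) / 4 : ℝ) : ℂ) by push_cast; ring,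
    Complex.exp_add, Complex.exp_two_pi_mul_I, one_mul]

/-! ### Part 2 — the node functions of the cell `(3/2; 7/2, 7/2)` (`B = 17/4`) at the two nodes -/

/-- `h_k(7/2) = (7/2)^k · e^{3iπ/4}` (`B − 7/2 = 3/4`). [folklore] -/
private theorem ddBase_cell_right (k : ℕ) :
    ddBase (17 / 4) k (7 / 2) = (((7 : ℝ) / 2 : ℝ) : ℂ) ^ k * cexp (I * π * (((3 : ℝ) / 4 : ℝ) : ℂ)) := by
  rw [ddBase]
  rw [show ((17 / 4 : ℝ) - 7 / 2) = (3 : ℝ) / 4 by norm_num]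

/-- `h_k(3/2) = (3/2)^k · e^{11iπ/4}` (`B − 3/2 = 11/4`). [folklore] -/
private theorem ddBase_cell_left (k : ℕ) :
    ddBase (17 / 4) k (3 / 2) = (((3 : ℝ) / 2 : ℝ) : ℂ) ^ k * cexp (I * π * (((11 : ℝ) / 4 : ℝ) : ℂ)) := by
  rw [ddBase]
  rw [show ((17 / 4 : ℝ) - 3 / 2) = (11 : ℝ) / 4 by norm_num]

/-- `h_k′(7/2) = (k(7/2)^{k−1} − iπ(7/2)^k) · e^{3iπ/4}`. [folklore] -/
private theorem ddBase'_cell_right (k : ℕ) :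
    ddBase' (17 / 4) k (7 / 2)
      = ((k : ℂ) * (((7 : ℝ) / 2 : ℝ) : ℂ) ^ (k - 1) - I * π * (((7 : ℝ) / 2 : ℝ) : ℂ) ^ k)
          * cexp (I * π * (((3 : ℝ) / 4 : ℝ) : ℂ)) := by
  rw [ddBase']
  rw [show ((17 / 4 : ℝ) - 7 / 2) = (3 : ℝ) / 4 by norm_num]

/-! ### Part 3 — the confluent divided differences of the cell (branch `y = z` of `Det.dd2`) -/

/-- The cell's half-sum `B = 17/4` and the branch: `(x^k g_B)[3/2, 7/2, 7/2] = ((h(3/2) − h(7/2))/(3/2 − 7/2) − h′(7/2))/(3/2 − 7/2)`.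
[cite: Zhang2022LandauSiegel, proof of Prop 7.1, (7.19)–(7.21)] -/
theorem ddOf_cell (k : ℕ) :
    ddOf ![3 / 2, 7 / 2, 7 / 2] k
      = ((ddBase (17 / 4) k (3 / 2) - ddBase (17 / 4) k (7 / 2)) / (((3 / 2 - 7 / 2 : ℝ) : ℝ) : ℂ)
          - ddBase' (17 / 4) k (7 / 2)) / (((3 / 2 - 7 / 2 : ℝ) : ℝ) : ℂ) := by
  rw [ddOf, dd2]
  simp only [shiftB, Matrix.cons_val_zero, Matrix.cons_val_one, Matrix.cons_val_two, Matrix.head_cons,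
    Matrix.tail_cons]
  norm_num only [ne_eq, not_false_eq_true, and_true, and_false, ite_false, ite_true, true_and, false_and,
    not_true_eq_false]


/-! ### Part 4 — the six confluent moments of the cell in closed form (`E = e^{3iπ/4}`) -/

/-- `g_B[3/2, 7/2, 7/2] = −(iπ/2)·E`. [cite: Zhang2022LandauSiegel, proof of Prop 7.1, (7.19)–(7.21)] -/
theorem ddOf_cell_zero : ddOf ![3 / 2, 7 / 2, 7 / 2] 0 = -(I * π / 2) * cexp (I * π * (((3 : ℝ) / 4 : ℝ) : ℂ)) := by
  rw [ddOf_cell, ddBase_cell_left, ddBase_cell_right, ddBase'_cell_right, cexp_eleven_pi_quarter]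
  push_cast
  ring

/-- `(x g_B)[3/2, 7/2, 7/2] = −(7iπ/4)·E`. [cite: Zhang2022LandauSiegel, proof of Prop 7.1, (7.19)–(7.21)] -/
theorem ddOf_cell_one : ddOf ![3 / 2, 7 / 2, 7 / 2] 1 = -(7 * I * π / 4) * cexp (I * π * (((3 : ℝ) / 4 : ℝ) : ℂ)) := by
  rw [ddOf_cell, ddBase_cell_left, ddBase_cell_right, ddBase'_cell_right, cexp_eleven_pi_quarter]
  push_cast
  ring

/-- `(x² g_B)[3/2, 7/2, 7/2] = (1 − 49iπ/8)·E`. [cite: Zhang2022LandauSiegel, proof of Prop 7.1, (7.19)–(7.21)] -/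
theorem ddOf_cell_two :
    ddOf ![3 / 2, 7 / 2, 7 / 2] 2 = (1 - 49 * I * π / 8) * cexp (I * π * (((3 : ℝ) / 4 : ℝ) : ℂ)) := by
  rw [ddOf_cell, ddBase_cell_left, ddBase_cell_right, ddBase'_cell_right, cexp_eleven_pi_quarter]
  push_cast
  ring

/-- `(x³ g_B)[3/2, 7/2, 7/2] = (17/2 − 343iπ/16)·E`. [cite: Zhang2022LandauSiegel, proof of Prop 7.1, (7.19)–(7.21)] -/
theorem ddOf_cell_three :
    ddOf ![3 / 2, 7 / 2, 7 / 2] 3 = (17 / 2 - 343 * I * π / 16) * cexp (I * π * (((3 : ℝ) / 4 : ℝ) : ℂ)) := by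
  rw [ddOf_cell, ddBase_cell_left, ddBase_cell_right, ddBase'_cell_right, cexp_eleven_pi_quarter]
  push_cast
  ring

/-- `m₀(3/2; 7/2, 7/2) = −(7iπ/4)·E`. [cite: Zhang2022LandauSiegel, proof of Prop 7.1, (7.19)–(7.21)] -/
theorem ddM0_cell : ddM0 ![3 / 2, 7 / 2, 7 / 2] = ((-(7 * π / 4) : ℝ) : ℂ) * I * cexp (I * π * (((3 : ℝ) / 4 : ℝ) : ℂ)) := by
  rw [ddM0, ddOf_cell_one]
  push_cast
  ring

/-- `m_b(3/2; 7/2, 7/2) = (1 − 49iπ/8)·E`. [cite: Zhang2022LandauSiegel, §8 (8.13)–(8.18)] -/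
theorem ddMb_cell :
    ddMb ![3 / 2, 7 / 2, 7 / 2] = (1 + ((-(49 * π / 8) : ℝ) : ℂ) * I) * cexp (I * π * (((3 : ℝ) / 4 : ℝ) : ℂ)) := by
  rw [ddMb, ddOf_cell_two]
  push_cast
  ring

/-- `m_s(3/2; 7/2, 7/2) = −(1 + 35iπ/4)·E`. [cite: Zhang2022LandauSiegel, §8 (8.13)–(8.18)] -/
theorem ddMs_cell :
    ddMs ![3 / 2, 7 / 2, 7 / 2] = (-1 + ((-(35 * π / 4) : ℝ) : ℂ) * I) * cexp (I * π * (((3 : ℝ) / 4 : ℝ) : ℂ)) := by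
  rw [ddMs, ddM0_cell, ddMb_cell]
  simp only [shiftB, Matrix.cons_val_zero, Matrix.cons_val_one, Matrix.cons_val_two, Matrix.head_cons,
    Matrix.tail_cons]
  push_cast
  ring

/-- `m_n(3/2; 7/2, 7/2) = −(147iπ/16)·E`. [cite: Zhang2022LandauSiegel, §8 (8.13)–(8.18)] -/
theorem ddMn_cell :
    ddMn ![3 / 2, 7 / 2, 7 / 2] = ((-(147 * π / 16) : ℝ) : ℂ) * I * cexp (I * π * (((3 : ℝ) / 4 : ℝ) : ℂ)) := by
  rw [ddMn, ddOf_cell_zero]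
  simp only [Matrix.cons_val_zero, Matrix.cons_val_one, Matrix.cons_val_two, Matrix.head_cons, Matrix.tail_cons]
  push_cast
  ring

/-- `m_bs(3/2; 7/2, 7/2) = −(245iπ/8)·E`. [cite: Zhang2022LandauSiegel, §8 (8.13)–(8.18)] -/
theorem ddMbs_cell :
    ddMbs ![3 / 2, 7 / 2, 7 / 2] = ((-(245 * π / 8) : ℝ) : ℂ) * I * cexp (I * π * (((3 : ℝ) / 4 : ℝ) : ℂ)) := by
  rw [ddMbs, ddMb_cell, ddOf_cell_three]
  simp only [shiftB, Matrix.cons_val_zero, Matrix.cons_val_one, Matrix.cons_val_two, Matrix.head_cons,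
    Matrix.tail_cons]
  push_cast
  ring

/-- `m_bn(3/2; 7/2, 7/2) = −(1029iπ/32)·E`. [cite: Zhang2022LandauSiegel, §8 (8.13)–(8.18)] -/
theorem ddMbn_cell :
    ddMbn ![3 / 2, 7 / 2, 7 / 2] = ((-(1029 * π / 32) : ℝ) : ℂ) * I * cexp (I * π * (((3 : ℝ) / 4 : ℝ) : ℂ)) := by
  rw [ddMbn, ddM0_cell]
  simp only [Matrix.cons_val_zero, Matrix.cons_val_one, Matrix.cons_val_two, Matrix.head_cons, Matrix.tail_cons]
  push_cast
  ring

/-! ### Part 5 — the profile integrals of the linear one-sided profile `g(y) = 1 − y` -/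

/-- `∫₀¹ (1 − x) dx = 1/2` (real). [folklore] -/
private theorem integral_one_sub : ∫ x in (0:ℝ)..1, (1 - x) = 1 / 2 := by
  rw [intervalIntegral.integral_sub intervalIntegrable_const intervalIntegrable_id, intervalIntegral.integral_const,
    integral_id, smul_eq_mul]
  norm_num

/-- `∫₀¹ (1 − x)² dx = 1/3` (real). [folklore] -/
private theorem integral_one_sub_sq : ∫ x in (0:ℝ)..1, (1 - x) ^ 2 = 1 / 3 := by
  have h := intervalIntegral.integral_comp_sub_left (fun x : ℝ => x ^ 2) (1 : ℝ) (a := 0) (b := 1)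
  simp only [sub_self, sub_zero] at h
  rw [h, integral_pow]
  norm_num

/-- `∫₀¹ g = 1/2`. [cite: Zhang2022LandauSiegel, §7 (7.2) p.44] -/
theorem integral_linProfile : ∫ x in (0:ℝ)..1, linProfile x = (((1 : ℝ) / 2 : ℝ) : ℂ) := by
  simp only [linProfile]
  rw [intervalIntegral.integral_ofReal, integral_one_sub]

/-- `∫₀¹ ‖g′‖² = 1`. [cite: Zhang2022LandauSiegel, §7 (7.2) p.44] -/
theorem integral_normSq_linProfile' : ∫ x in (0:ℝ)..1, ‖linProfile' x‖ ^ 2 = 1 := by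
  simp [linProfile']

/-- `∫₀¹ g′·conj g = −1/2`. [cite: Zhang2022LandauSiegel, §7 (7.2) p.44] -/
theorem integral_linProfile'_mul_conj :
    ∫ x in (0:ℝ)..1, linProfile' x * (starRingEnd ℂ) (linProfile x) = ((-((1 : ℝ) / 2) : ℝ) : ℂ) := by
  have h : (fun x : ℝ => linProfile' x * (starRingEnd ℂ) (linProfile x)) = fun x => ((-(1 - x) : ℝ) : ℂ) := by
    funext x; simp [linProfile, linProfile', Complex.conj_ofReal]
  rw [h, intervalIntegral.integral_ofReal, intervalIntegral.integral_neg, integral_one_sub]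

/-- `∫₀¹ g·conj g′ = −1/2`. [cite: Zhang2022LandauSiegel, §7 (7.2) p.44] -/
theorem integral_linProfile_mul_conj' :
    ∫ x in (0:ℝ)..1, linProfile x * (starRingEnd ℂ) (linProfile' x) = ((-((1 : ℝ) / 2) : ℝ) : ℂ) := by
  have h : (fun x : ℝ => linProfile x * (starRingEnd ℂ) (linProfile' x)) = fun x => ((-(1 - x) : ℝ) : ℂ) := by
    funext x; simp [linProfile, linProfile']
  rw [h, intervalIntegral.integral_ofReal, intervalIntegral.integral_neg, integral_one_sub]

/-- `∫₀¹ ‖g‖² = 1/3`. [cite: Zhang2022LandauSiegel, §7 (7.2) p.44] -/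
theorem integral_normSq_linProfile : ∫ x in (0:ℝ)..1, ‖linProfile x‖ ^ 2 = 1 / 3 := by
  have h : (fun x : ℝ => ‖linProfile x‖ ^ 2) = fun x => (1 - x) ^ 2 := by
    funext x
    simp only [linProfile, Complex.norm_real, Real.norm_eq_abs, sq_abs]
  rw [h, integral_one_sub_sq]

/-- `g(0) = 1`. [cite: Zhang2022LandauSiegel, §7 (7.2) p.44] -/
theorem linProfile_zero : linProfile 0 = 1 := by
  simp [linProfile]

/-- The inner primitive `∫₀ˣ g = x − x²/2`. [cite: Zhang2022LandauSiegel, §7 (7.2) p.44] -/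
theorem integral_linProfile_upto (x : ℝ) : ∫ t in (0:ℝ)..x, linProfile t = (((x - x ^ 2 / 2) : ℝ) : ℂ) := by
  simp only [linProfile]
  rw [intervalIntegral.integral_ofReal, intervalIntegral.integral_sub intervalIntegrable_const intervalIntegrable_id,
    intervalIntegral.integral_const, integral_id, smul_eq_mul]
  push_cast
  ring

/-- `∫₀¹ g(x)·conj(∫₀ˣ g) dx = 1/8`. [cite: Zhang2022LandauSiegel, §7 (7.2) p.44; §8 (8.11)–(8.12)] -/
theorem integral_linProfile_mul_conj_prim :
    ∫ x in (0:ℝ)..1, linProfile x * (starRingEnd ℂ) (∫ t in (0:ℝ)..x, linProfile t) = (((1 : ℝ) / 8 : ℝ) : ℂ) := by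
  have h : (fun x : ℝ => linProfile x * (starRingEnd ℂ) (∫ t in (0:ℝ)..x, linProfile t))
      = fun x => (((1 - x) * (x - x ^ 2 / 2) : ℝ) : ℂ) := by
    funext x
    rw [integral_linProfile_upto]
    simp only [linProfile, Complex.conj_ofReal]
    push_cast
    ring
  rw [h, intervalIntegral.integral_ofReal]
  have hF : ∀ x : ℝ, HasDerivAt (fun x : ℝ => x ^ 2 / 2 - x ^ 3 / 2 + x ^ 4 / 8) ((1 - x) * (x - x ^ 2 / 2)) x := by
    intro x
    have h2 := (((hasDerivAt_pow 2 x).div_const 2).sub ((hasDerivAt_pow 3 x).div_const 2)).add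
      ((hasDerivAt_pow 4 x).div_const 8)
    refine h2.congr_deriv ?_
    simp
    ring
  rw [intervalIntegral.integral_eq_sub_of_hasDerivAt (fun x _ => hF x)
    ((by fun_prop : Continuous fun x : ℝ => (1 - x) * (x - x ^ 2 / 2)).intervalIntegrable 0 1)]
  push_cast
  norm_num


/-! ### Part 6 — THE WITNESS VALUE: `F_{(3/2; 7/2, 7/2)}(1 − y) = √2·(11/4 − 21π/16 + 833π²/96 − 1029π³/256) < 0` -/

/-- **The recipe form of the confluent cell `(3/2; 7/2, 7/2)` on the linear profile, in closed form.**
[cite: Zhang2022LandauSiegel, Prop 7.1 p.44 with (7.2), (7.19)–(7.21); §8 (8.11)–(8.23)] -/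
theorem formDetDD_cell_lin :
    FormDetDD ![3 / 2, 7 / 2, 7 / 2] linProfile linProfile'
      = Real.sqrt 2 * (11 / 4 - 21 / 16 * π + 833 / 96 * π ^ 2 - 1029 / 256 * π ^ 3) := by
  unfold FormDetDD SixMomentOf
  rw [ddM0_cell, ddMs_cell, ddMn_cell, ddMb_cell, ddMbs_cell, ddMbn_cell, integral_normSq_linProfile',
    integral_linProfile'_mul_conj, integral_linProfile_mul_conj', integral_normSq_linProfile, linProfile_zero,
    integral_linProfile, integral_linProfile_mul_conj_prim, cexp_three_pi_quarter]
  simp only [Complex.mul_re, Complex.mul_im, Complex.add_re, Complex.add_im, Complex.sub_re, Complex.sub_im,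
    Complex.neg_re, Complex.neg_im, Complex.ofReal_re, Complex.ofReal_im, Complex.I_re, Complex.I_im,
    Complex.one_re, Complex.one_im, Complex.conj_ofReal, mul_one, mul_zero, zero_mul, one_mul, sub_zero, zero_sub,
    add_zero, zero_add]
  field_simp
  ring

/-- The cubic is negative for every `t > 3` (it decreases past `t ≈ 0.72` and is already `< 0` at `t = 3`). [folklore] -/
private theorem cubic_neg {t : ℝ} (ht : 3 < t) : 11 / 4 - 21 / 16 * t + 833 / 96 * t ^ 2 - 1029 / 256 * t ^ 3 < 0 := by
  nlinarith [sq_nonneg (t - 3), mul_pos (sub_pos.2 ht) (sub_pos.2 ht), sq_nonneg t,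
    mul_pos (by positivity : (0:ℝ) < t ^ 2) (sub_pos.2 ht)]

/-- **THE K9 WITNESS: `F_{(3/2; 7/2, 7/2)}(1 − y) < 0`** (`≈ −57.084`).
[cite: Zhang2022LandauSiegel, Prop 7.1 p.44 with (7.2), (7.19)–(7.21); §8 (8.11)–(8.23)] -/
theorem formDetDD_cell_lin_neg : FormDetDD ![3 / 2, 7 / 2, 7 / 2] linProfile linProfile' < 0 := by
  rw [formDetDD_cell_lin]
  exact mul_neg_of_pos_of_neg (Real.sqrt_pos.2 (by norm_num)) (cubic_neg Real.pi_gt_three)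

/-! ### Part 7 — K9: the anchor window of E-102 head 1 is SHARP -/

/-- **K9 — the entangled cone FAILS at the anchor `a₀ = 3/2` (single-node palette `(7/2)`):** `¬ ConePSD (3/2) (7/2)`
— the linear one-sided profile `1 − y` is a negative direction of the `1 × 1` block `F_{(3/2; 7/2, 7/2)}`.
[cite: Zhang2022LandauSiegel, Prop 7.1 p.44 with (7.2), (7.19)–(7.21); §8 (8.11)–(8.23)] -/
theorem not_conePSD_threeHalves : ¬ ConePSD (3 / 2 : ℝ) ![(7 / 2 : ℝ)] := by
  intro h
  have h0 := (conePSD_fin_one_iff (3 / 2 : ℝ) (7 / 2)).1 h linProfile linProfile' kinkedProfile_lin linProfile_one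
  exact absurd h0 (not_le.2 formDetDD_cell_lin_neg)

/-- **No anchor set containing `3/2` and no shift set containing `7/2` carry the cone row.**
[cite: Zhang2022LandauSiegel, Prop 7.1 p.44 with (7.2), (7.19)–(7.21)] -/
theorem not_edetCone_of_mem {A B : Set ℝ} (hA : (3 / 2 : ℝ) ∈ A) (hB : (7 / 2 : ℝ) ∈ B) : ¬ EdetCone A B :=
  fun hE => not_conePSD_threeHalves (hE.conePSD hA (b := ![(7 / 2 : ℝ)]) fun j => by fin_cases j; simpa using hB)

/-- In particular the anchor window of record cannot be extended past `3/2`: `¬ EdetCone (0, a′) (0,5)` for every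
`a′ > 3/2`. [cite: Zhang2022LandauSiegel, Prop 7.1 p.44 with (7.2), (7.19)–(7.21)] -/
theorem not_edetCone_Ioo_of_gt {a' : ℝ} (ha' : 3 / 2 < a') : ¬ EdetCone (Set.Ioo 0 a') (Set.Ioo 0 5) :=
  not_edetCone_of_mem ⟨by norm_num, ha'⟩ ⟨by norm_num, by norm_num⟩

/-- … e.g. the anchor box `(0,2)` (the range of L-B′1) FAILS: `¬ EdetCone (0,2) (0,5)`.
[cite: Zhang2022LandauSiegel, Prop 7.1 p.44 with (7.2), (7.19)–(7.21)] -/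
theorem not_edetCone_Ioo_two : ¬ EdetCone (Set.Ioo 0 2) (Set.Ioo 0 5) :=
  not_edetCone_Ioo_of_gt (by norm_num)

/-- … and the closed anchor window `[0, 3/2]` FAILS, while `[0,1]` holds (`Det.edetCone_Icc`): the kernel window of
E-102 head 1 in the anchor lies between `[0,1]` and `[0, 3/2)`. [cite: Zhang2022LandauSiegel, Prop 7.1 p.44 with (7.2), (7.19)–(7.21)] -/
theorem not_edetCone_Icc_threeHalves : ¬ EdetCone (Set.Icc 0 (3 / 2)) (Set.Ioo 0 5) :=
  not_edetCone_of_mem ⟨by norm_num, le_rfl⟩ ⟨by norm_num, by norm_num⟩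

/-- The two-sided statement for KNIFE-EDGES §4: the row holds on `[0,1]` and fails on every anchor set reaching `3/2`.
[cite: Zhang2022LandauSiegel, Prop 7.1 p.44 with (7.2), (7.19)–(7.21); §8 (8.11)–(8.23)] -/
theorem edetCone_window_Icc_and_not :
    EdetCone (Set.Icc 0 1) (Set.Ioo 0 5) ∧ ¬ EdetCone (Set.Icc 0 (3 / 2)) (Set.Ioo 0 5) :=
  ⟨edetCone_Icc _, not_edetCone_Icc_threeHalves⟩

end Det

end Literature.NumberTheory.LFunctions.Zhang2022
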